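import Mathlib
import Literature.NumberTheory.LFunctions.Zhang2022.AppendixBLemma151Prelims
import Literature.NumberTheory.LFunctions.Zhang2022.Section18DefsE
import Literature.NumberTheory.Sieve.DivisorBound
import HarnessLib

/-!
# Zhang (2022) App. B, Lemma 15.1: the μ = 1 truncated evaluation at a GENERAL (B.3)-tail value
# (RT-05 E-chain; theorem only)

Topic `Literature/NumberTheory/LFunctions/Zhang2022` (Landau–Siegel audit tree; verdict-neutral).
Y. Zhang, *Discrete mean estimates and the Landau–Siegel zero*, arXiv:2211.02515v1 (2022)
[Zhang2022LandauSiegel] — an unrefereed manuscript under adjudication; nothing here asserts or denies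
its Theorems 1–2. Lane ZHANG-L, RE-TYPE RT-05 (zl-lead R-22/R-28; zl-ref-chief C1–C5; the 𝔢-chain
PARAMETRISED over the value of `e″₁ⱼ`, instantiated at the DERIVED `AppendixB.e1ppD`). This file
re-proves the tree's `Skeleton.hmu1_of_u012_B3` (`AppendixBLemma151Prelims`: "`e₁ⱼ = e′₁ⱼ − e″₁ⱼ` on
the truncated weight `ϰ₁·[· < P^{1/2}]` from `StepB_u012` and (B.3)") VERBATIM with (i) the (B.3) tail
value `e1ppj` replaced by an ARBITRARY `E″ : ℕ → ℂ` (hypothesis "`tailB3 = E″ j + O(α₁)`" stated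
inline; at `E″ := e1ppD` it is `AppendixBTailB3Value.tailB3_sub_e1ppD_of`), (ii) the rate `α₁ = α log T`
of record (`StepB_u012R`; the boundary term `≪ 𝓛⁻⁸ ≤ α𝓛 ≤ α₁`, `Skeleton.alpha_mul_ell_le_alpha1`),
concluding the μ = 1 input `hmu1` of `Skeleton.lemma151ChiRE_of_partsR` at the value
`e1jE E″ j = e′₁ⱼ − E″ j` (`Section18DefsE`). Theorem only; no new claims.
WHAT THIS IS NOT: a proof of `StepB_u012R` or of the (B.3) tail evaluation, nor any claim about
Theorems 1–2 of the manuscript or Landau–Siegel zeros.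

## References
* Y. Zhang, arXiv:2211.02515v1 (2022), App. B (B.3), pp. 107–108; §15 Lemma 15.1 p. 86.
  [cite: Zhang2022LandauSiegel, App. B (B.3), pp.107–108]
-/

noncomputable section

open Complex Real ComplexConjugate

namespace Literature.NumberTheory.LFunctions.Zhang2022.Skeleton

open Typed.AppendixB (varrhoJ vkSum tailB3)

section MuOneE

variable (c' : ℝ)

/-- **The `μ = 1` truncated evaluation from `StepB_u012R` and a (B.3)-tail evaluation AT VALUE `E″`, rate `α₁`** (RT-05 generic twin of `hmu1_of_u012_B3`: conclusion at the μ₁-value `e1jE E″ j = e′₁ⱼ − E″ j`; at `E″ := AppendixB.e1ppD` the tail input is `AppendixBTailB3Value.tailB3_sub_e1ppD_of`). Original docstring: **the `μ = 1` truncated evaluation: "`e_{1j} = e′_{1j} − e″_{1j}`"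
on the weight `ϰ₁·[· < P^{1/2}]` of `b` (the boundary term `l₁l = P^{1/2}` is absorbed: it is
`≪ l^{−7/8} ≤ D^{−21/8} ≪ 𝓛⁻⁸`). Supplies `hmu1` of `lemma151Chi_of_parts`.
[cite: Zhang2022LandauSiegel, App. B (B.3), p.107–108] -/
theorem hmu1E_of_u012R_tail (E'' : ℕ → ℂ) (h12 : Typed.AppendixB.StepB_u012R c')
    (hB3 : ∃ C : ℝ, ForAllLarge fun D _ _ => ∀ j ∈ ({1, 2, 3} : Finset ℕ), ∀ l₁ : ℕ, 1 ≤ l₁ →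
      l₁ ∈ nset (frakq D) → (l₁ : ℝ) < bigT D → ‖tailB3 c' D j l₁ - E'' j‖ ≤ C * alpha1 D) :
    ∃ C : ℝ, ForAllLarge fun D _ _ => ∀ j ∈ ({1, 2, 3} : Finset ℕ), ∀ l₁ : ℕ, 1 ≤ l₁ →
      l₁ ∈ nset (frakq D) → (l₁ : ℝ) < bigT D →
        ‖vkSum c' D (fun m => if (m : ℝ) < bigP D ^ (1 / 2 : ℝ) then vk1 D m else 0) j l₁ -
            e1jE E'' j‖ ≤ C * alpha1 D := by
  obtain ⟨C₁, h₁⟩ := h12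
  obtain ⟨C₂, h₂⟩ := hB3
  obtain ⟨Cd, hCd1, hCd⟩ := Sieve.exists_card_divisors_le_mul_rpow' (by norm_num : (0 : ℝ) < 1 / 8)
  set ε : ℝ := 21 / 64 with hε
  obtain ⟨D₀, h⟩ := h₁.and h₂
  refine ⟨C₁ + C₂ + Cd * ε⁻¹ ^ 8 / π, max D₀ 8, fun D _ χ hD hq hp j hj l₁ hl₁ hl₁n hl₁T => ?_⟩
  obtain ⟨e₁, e₂⟩ := h D χ (le_trans (le_max_left _ _) hD) hq hp
  have hD8 : 8 ≤ D := le_trans (le_max_right _ _) hD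
  have hD0 : (0 : ℝ) < D := by exact_mod_cast (show 0 < D by omega)
  have hlog : 2 ≤ Real.log D := by
    have h8 : (8 : ℝ) ≤ D := by exact_mod_cast hD8
    have he2 : Real.exp 2 ≤ 8 := by
      have hh : Real.exp 2 = Real.exp 1 * Real.exp 1 := by rw [← Real.exp_add]; norm_num
      rw [hh]; nlinarith [Real.exp_one_lt_d9, Real.exp_pos 1]
    calc (2 : ℝ) = Real.log (Real.exp 2) := (Real.log_exp 2).symm
      _ ≤ Real.log 8 := Real.log_le_log (Real.exp_pos _) he2
      _ ≤ Real.log D := Real.log_le_log (by norm_num) h8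
  have hℓ2 : 2 ≤ ell D := hlog
  have hℓ0 : 0 < ell D := by linarith
  have g₁ := e₁ j hj l₁ hl₁ hl₁n hl₁T
  have g₂ := e₂ j hj l₁ hl₁ hl₁n hl₁T
  -- notation
  set y : ℝ := bigP D ^ (1 / 2 : ℝ) with hy
  have hy0 : 0 < y := Real.rpow_pos_of_pos (Real.exp_pos _) _
  have hl₁0 : (0 : ℝ) < l₁ := by exact_mod_cast hl₁
  set R₀ : Finset ℕ := Finset.Ico 1 ⌈bigP D⌉₊ with hR₀
  set F : ℕ → ℂ := fun l => vk1 D (l₁ * l) * varrhoJ c' D j l / (l : ℂ) with hF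
  -- the three pieces of the full `ϰ₁`-sum
  have hfull : vkSum c' D (vk1 D) j l₁ =
      (∑ l ∈ R₀.filter (fun l : ℕ => ((l₁ * l : ℕ) : ℝ) < y), F l) +
      ((∑ l ∈ R₀.filter (fun l : ℕ => ((l₁ * l : ℕ) : ℝ) = y), F l) + tailB3 c' D j l₁) := by
    rw [vkSum, tailB3, ← hR₀]
    rw [← Finset.sum_filter_add_sum_filter_not R₀ (fun l : ℕ => ((l₁ * l : ℕ) : ℝ) < y)]
    congr 1
    rw [← Finset.sum_filter_add_sum_filter_not (R₀.filter fun l : ℕ => ¬ ((l₁ * l : ℕ) : ℝ) < y)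
      (fun l : ℕ => ((l₁ * l : ℕ) : ℝ) = y), Finset.filter_filter, Finset.filter_filter]
    congr 1
    · refine Finset.sum_congr (Finset.filter_congr fun l _ => ?_) fun _ _ => rfl
      constructor
      · rintro ⟨-, h⟩; exact h
      · intro h; exact ⟨by rw [h]; exact lt_irrefl _, h⟩
    · refine Finset.sum_congr (Finset.filter_congr fun l _ => ?_) fun _ _ => rfl
      rw [Nat.cast_mul, div_lt_iff₀' hl₁0]
      constructor
      · rintro ⟨h1, h2⟩; exact lt_of_le_of_ne (not_lt.mp h1) (Ne.symm h2)
      · intro h; exact ⟨not_lt.mpr h.le, ne_of_gt h⟩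
  have htrunc : vkSum c' D (fun m => if (m : ℝ) < bigP D ^ (1 / 2 : ℝ) then vk1 D m else 0) j l₁ =
      ∑ l ∈ R₀.filter (fun l : ℕ => ((l₁ * l : ℕ) : ℝ) < y), F l := by
    rw [vkSum, ← hR₀, Finset.sum_filter]
    refine Finset.sum_congr rfl fun l _ => ?_
    simp only [hF, hy]
    split_ifs <;> simp
  -- the boundary term
  have hbd : ‖∑ l ∈ R₀.filter (fun l : ℕ => ((l₁ * l : ℕ) : ℝ) = y), F l‖ ≤
      Cd * ε⁻¹ ^ 8 / π * (alpha D * ell D) := by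
    have hcard : (R₀.filter (fun l : ℕ => ((l₁ * l : ℕ) : ℝ) = y)).card ≤ 1 := by
      refine Finset.card_le_one.mpr fun a ha b hb => ?_
      have ha' := (Finset.mem_filter.mp ha).2
      have hb' := (Finset.mem_filter.mp hb).2
      have : ((l₁ * a : ℕ) : ℝ) = ((l₁ * b : ℕ) : ℝ) := by rw [ha', hb']
      have : l₁ * a = l₁ * b := by exact_mod_cast this
      exact Nat.eq_of_mul_eq_mul_left hl₁ this
    -- bound for the (at most one) term
    have hterm : ∀ l ∈ R₀.filter (fun l : ℕ => ((l₁ * l : ℕ) : ℝ) = y),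
        ‖F l‖ ≤ Cd * ε⁻¹ ^ 8 / π * (alpha D * ell D) := by
      intro l hl
      obtain ⟨hlR, hly⟩ := Finset.mem_filter.mp hl
      have hl1 : 1 ≤ l := (Finset.mem_Ico.mp hlR).1
      have hl0 : (0 : ℝ) < l := by exact_mod_cast hl1
      -- `l ≥ y/T ≥ D³`
      have hlD : (D : ℝ) ^ 3 ≤ l := by
        have h1 : y / bigT D ≤ y / l₁ :=
          div_le_div_of_nonneg_left hy0.le hl₁0 hl₁T.le
        have h2 : y / l₁ = l := by
          rw [div_eq_iff hl₁0.ne', mul_comm]; exact_mod_cast hly.symm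
        calc (D : ℝ) ^ 3 ≤ y / bigT D := cube_le_sqrtP_div_T hℓ2
          _ ≤ l := by rw [← h2]; exact h1
      have hD1 : (1 : ℝ) ≤ D := by exact_mod_cast (show 1 ≤ D by omega)
      have hDl : (D : ℝ) ^ 3 ≤ l := hlD
      -- `‖F l‖ ≤ τ(l)/l ≤ Cd l^{-7/8} ≤ Cd D^{-21/8}`
      have hF1 : ‖F l‖ ≤ Cd * (l : ℝ) ^ (1 / 8 : ℝ) / l := by
        simp only [hF]
        rw [norm_div, norm_mul, Complex.norm_natCast]
        refine div_le_div_of_nonneg_right ?_ hl0.le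
        calc ‖vk1 D (l₁ * l)‖ * ‖varrhoJ c' D j l‖ ≤ 1 * (l.divisors.card : ℝ) := by
              gcongr
              · exact norm_vk1_le hlog _
              · exact norm_varrhoJ_le c' D j l
          _ ≤ Cd * (l : ℝ) ^ (1 / 8 : ℝ) := by rw [one_mul]; exact hCd l
      have hF2 : Cd * (l : ℝ) ^ (1 / 8 : ℝ) / l = Cd * (l : ℝ) ^ (-(7 / 8) : ℝ) := by
        rw [mul_div_assoc, ← Real.rpow_sub_one hl0.ne']
        all_goals norm_num
      have hF3 : (l : ℝ) ^ (-(7 / 8) : ℝ) ≤ ((D : ℝ) ^ 3) ^ (-(7 / 8) : ℝ) :=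
        Real.rpow_le_rpow_of_nonpos (by positivity) hDl (by norm_num)
      have hF4 : ((D : ℝ) ^ 3) ^ (-(7 / 8) : ℝ) = (D : ℝ) ^ (-(21 / 8) : ℝ) := by
        rw [← Real.rpow_natCast, ← Real.rpow_mul hD0.le]; norm_num
      -- `𝓛⁸ ≤ ε⁻⁸ D^{21/8}` (`log D ≤ D^ε/ε`, `ε = 21/64`)
      have hL : ell D ≤ (D : ℝ) ^ ε / ε := Real.log_le_rpow_div hD0.le (by norm_num)
      have hL8 : ell D ^ 8 ≤ ε⁻¹ ^ 8 * (D : ℝ) ^ ((21 / 8) : ℝ) := by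
        calc ell D ^ 8 ≤ ((D : ℝ) ^ ε / ε) ^ 8 := by gcongr
          _ = ε⁻¹ ^ 8 * ((D : ℝ) ^ ε) ^ 8 := by rw [div_eq_mul_inv, mul_pow, mul_comm]
          _ = ε⁻¹ ^ 8 * (D : ℝ) ^ ((21 / 8) : ℝ) := by
              rw [← Real.rpow_natCast ((D : ℝ) ^ ε), ← Real.rpow_mul hD0.le, hε]; norm_num
      -- `α𝓛 = π/𝓛⁸`
      have haℓ : alpha D * ell D = π / ell D ^ 8 := by
        have h9 : alpha D * ell D ^ 9 = π := by
          rw [alpha, bigP, Real.log_exp, div_mul_cancel₀ _ (pow_ne_zero _ hℓ0.ne')]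
        rw [eq_div_iff (pow_ne_zero _ hℓ0.ne'), ← h9]; ring
      have hDpow : (D : ℝ) ^ (-(21 / 8) : ℝ) = ((D : ℝ) ^ ((21 / 8) : ℝ))⁻¹ := by
        rw [← Real.rpow_neg hD0.le]
      have hD218 : 0 < (D : ℝ) ^ ((21 / 8) : ℝ) := Real.rpow_pos_of_pos hD0 _
      calc ‖F l‖ ≤ Cd * (l : ℝ) ^ (-(7 / 8) : ℝ) := by rw [← hF2]; exact hF1
        _ ≤ Cd * (D : ℝ) ^ (-(21 / 8) : ℝ) := by
            rw [← hF4]; exact mul_le_mul_of_nonneg_left hF3 (by linarith)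
        _ = Cd * ((D : ℝ) ^ ((21 / 8) : ℝ))⁻¹ := by rw [hDpow]
        _ ≤ Cd * (ε⁻¹ ^ 8 / ell D ^ 8) := by
            refine mul_le_mul_of_nonneg_left ?_ (by linarith)
            rw [le_div_iff₀ (pow_pos hℓ0 8), inv_mul_le_iff₀ hD218, mul_comm]
            exact hL8
        _ = Cd * ε⁻¹ ^ 8 / π * (π / ell D ^ 8) := by field_simp
        _ = Cd * ε⁻¹ ^ 8 / π * (alpha D * ell D) := by rw [haℓ]
    have hB0 : 0 ≤ Cd * ε⁻¹ ^ 8 / π * (alpha D * ell D) := by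
      have : 0 < alpha D := by
        rw [alpha, bigP, Real.log_exp]; exact div_pos Real.pi_pos (pow_pos hℓ0 _)
      have : 0 ≤ Cd := by linarith
      positivity
    calc ‖∑ l ∈ R₀.filter (fun l : ℕ => ((l₁ * l : ℕ) : ℝ) = y), F l‖
        ≤ ∑ l ∈ R₀.filter (fun l : ℕ => ((l₁ * l : ℕ) : ℝ) = y), ‖F l‖ := norm_sum_le _ _
      _ ≤ (R₀.filter (fun l : ℕ => ((l₁ * l : ℕ) : ℝ) = y)).card • (Cd * ε⁻¹ ^ 8 / π * (alpha D * ell D)) :=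
          Finset.sum_le_card_nsmul _ _ _ hterm
      _ ≤ 1 • (Cd * ε⁻¹ ^ 8 / π * (alpha D * ell D)) := nsmul_le_nsmul_left hB0 hcard
      _ = Cd * ε⁻¹ ^ 8 / π * (alpha D * ell D) := one_nsmul _
  -- assembly: `trunc − e₁ = (full − e′₁) − (tail − e″₁) − boundary`
  have key : vkSum c' D (fun m => if (m : ℝ) < bigP D ^ (1 / 2 : ℝ) then vk1 D m else 0) j l₁ -
        e1jE E'' j
      = (vkSum c' D (vk1 D) j l₁ - e1pj j) - (tailB3 c' D j l₁ - E'' j) -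
        ∑ l ∈ R₀.filter (fun l : ℕ => ((l₁ * l : ℕ) : ℝ) = y), F l := by
    rw [htrunc, hfull, e1jE]; ring
  have hD3 : 3 ≤ D := le_trans (by norm_num) hD8
  have hαα1 : alpha D * ell D ≤ alpha1 D := alpha_mul_ell_le_alpha1 hD3
  have hCd0 : 0 ≤ Cd * ε⁻¹ ^ 8 / π := by
    have : 0 ≤ Cd := by linarith
    positivity
  rw [key]
  calc _ ≤ ‖vkSum c' D (vk1 D) j l₁ - e1pj j‖ + ‖tailB3 c' D j l₁ - E'' j‖ +
        ‖∑ l ∈ R₀.filter (fun l : ℕ => ((l₁ * l : ℕ) : ℝ) = y), F l‖ := norm_sub_le_of_le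
          (norm_sub_le _ _) le_rfl
    _ ≤ C₁ * alpha1 D + C₂ * alpha1 D + Cd * ε⁻¹ ^ 8 / π * (alpha D * ell D) :=
        add_le_add (add_le_add g₁ g₂) hbd
    _ ≤ C₁ * alpha1 D + C₂ * alpha1 D + Cd * ε⁻¹ ^ 8 / π * alpha1 D := by
        gcongr
    _ = (C₁ + C₂ + Cd * ε⁻¹ ^ 8 / π) * alpha1 D := by ring

end MuOneE

end Literature.NumberTheory.LFunctions.Zhang2022.Skeleton
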